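import Mathlib.NumberTheory.NumberField.CanonicalEmbedding.Basic
import Mathlib.NumberTheory.NumberField.InfinitePlace.TotallyRealComplex
import Literature.MeasureTheory.Group.LatticeSumDilationBound
import HarnessLib

/-!
# Sums of product weights over translates of `𝓞_K` in the real embedding space of a totally real field

Topic `NumberTheory/NumberFields`; namespace `Literature.NumberTheory.NumberFields`.  KERNEL only: proved theorems, no definition,
no named fact, no `sorry`.

Let `K` be a totally real number field with real places `w₁, …, w_d` and real embeddings `σ_w : K → ℝ`.  The image of `𝓞_K` under
`x ↦ (σ_w x)_w` is a full lattice in `ℝ^d` (Mathlib: `mixedEmbedding.integerLattice`, here read in the real coordinates of the mixed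
space, which for a totally real field has no complex factor).  Transporting ★ `LatticeSumDilationBound`
(`exists_tsum_prod_apply_div_le`) along this identification gives `exists_forall_tsum_ringOfIntegers_prod_le`:

  there is `C = C(K) ≥ 0` such that for all even-antitone integrable weights `g_w ≥ 0`, all `T > 0` and all `a ∈ ℝ^d`,
  `Σ_{x ∈ 𝓞_K} Π_w g_w((a_w + σ_w x)/T) ≤ C · (1 + T^d) · Π_w (g_w(0) + ∫ g_w)`,

uniformly in the translate `a` — the archimedean "count" `M = O(T^d)` that ★ `DenominatorIdealRegrouping` consumes
(its hypothesis `hM`).  [Weil1965, n° 12, Lemme 5 (proof, pp. 21–22): the number of lattice points in a translated box;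
n° 41: its use for the Fourier coefficients of Eisenstein–Siegel series.]  Cell `hodgecm-mathlib`, FLOOR 0, E-2 desk, crux item
H413, row SW2c-BOUND (E3′).  HC_CM is proved only modulo the 7 printed citations until rung 0 closes; this file is unconditional.

## References
* [Weil1965] A. Weil, *Sur la formule de Siegel dans la théorie des groupes classiques*, Acta Math. 113 (1965), n° 12 & 41.
* [Garrett2018] P. Garrett, *Modern Analysis of Automorphic Forms by Example* (2018), §2.3.
-/

set_option autoImplicit false

noncomputable section

open NumberField NumberField.InfinitePlace NumberField.mixedEmbedding
open _root_.MeasureTheory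

namespace Literature.NumberTheory.NumberFields

variable (K : Type*) [Field K] [NumberField K]

omit [NumberField K] in
/-- A totally real field has no complex place. [cite: Weil1965, n° 41] -/
theorem isEmpty_isComplex_of_isTotallyReal [IsTotallyReal K] :
    IsEmpty {w : InfinitePlace K // IsComplex w} :=
  ⟨fun w => (not_isReal_iff_isComplex.mpr w.2) (IsTotallyReal.isReal w.1)⟩

/-- **Uniform count over translates of `𝓞_K` (totally real `K`).**  There is `C ≥ 0` such that for every family of
non-negative, even-antitone (`|s| ≤ |t| → g t ≤ g s`), integrable weights `g_w` indexed by the real places, every `T > 0`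
and every translate `a`,
`Σ_{x ∈ 𝓞_K} Π_w g_w((a_w + σ_w(x))/T) ≤ C·(1 + T^d)·Π_w (g_w(0) + ∫ g_w)` (`d = [K:ℚ]` = number of (real) places), the series being
summable. [cite: Weil1965, n° 12, Lemme 5 (proof)] -/
theorem exists_forall_tsum_ringOfIntegers_prod_le [IsTotallyReal K] :
    ∃ C : ℝ, 0 ≤ C ∧ ∀ g : InfinitePlace K → ℝ → ℝ,
      (∀ w t, 0 ≤ g w t) → (∀ w s t, |s| ≤ |t| → g w t ≤ g w s) → (∀ w, Integrable (g w)) →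
      ∀ T : ℝ, 0 < T → ∀ a : InfinitePlace K → ℝ,
        Summable (fun x : 𝓞 K =>
          ∏ w, g w ((a w + embedding_of_isReal (IsTotallyReal.isReal w) (x : K)) / T)) ∧
        ∑' x : 𝓞 K, ∏ w, g w ((a w + embedding_of_isReal (IsTotallyReal.isReal w) (x : K)) / T) ≤
          C * (1 + T ^ Fintype.card (InfinitePlace K)) * ∏ w, (g w 0 + ∫ t, g w t) := by
  classical
  haveI : IsEmpty {w : InfinitePlace K // IsComplex w} := isEmpty_isComplex_of_isTotallyReal K
  letI : Unique ({w : InfinitePlace K // IsComplex w} → ℂ) := Pi.uniqueOfIsEmpty _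
  -- all places are real: reindexing
  let σ : {w : InfinitePlace K // IsReal w} ≃ InfinitePlace K := Equiv.subtypeUnivEquiv IsTotallyReal.isReal
  have hprod : ∀ f : InfinitePlace K → ℝ, ∏ i : {w : InfinitePlace K // IsReal w}, f i.1 = ∏ w, f w :=
    fun f => Fintype.prod_equiv σ _ _ fun _ => rfl
  have hcard : Fintype.card {w : InfinitePlace K // IsReal w} = Fintype.card (InfinitePlace K) :=
    Fintype.card_congr σ
  -- real coordinates of the mixed space of a totally real field
  let e : ({w : InfinitePlace K // IsReal w} → ℝ) ≃L[ℝ] mixedSpace K :=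
    (ContinuousLinearEquiv.prodUnique ℝ ({w : InfinitePlace K // IsReal w} → ℝ)
      ({w : InfinitePlace K // IsComplex w} → ℂ)).symm
  have he : ∀ y : mixedSpace K, e.symm y = y.1 := fun y => rfl
  -- `𝓞_K` read in real coordinates is a full lattice
  obtain ⟨C, hC0, hC⟩ := Literature.MeasureTheory.Group.exists_tsum_prod_apply_div_le
    (ZLattice.comap ℝ (mixedEmbedding.integerLattice K) e.toLinearMap)
  refine ⟨C, hC0, fun g hg0 hanti hint T hT a => ?_⟩
  obtain ⟨hsum, hle⟩ := hC (fun i => g i.1) (fun i => hg0 i.1) (fun i => hanti i.1) (fun i => hint i.1)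
    T hT (fun i => a i.1)
  rw [hcard, hprod (fun w => g w 0 + ∫ t, g w t)] at hle
  -- the bijection `𝓞_K ≃ lattice`
  have hmem : ∀ y : {w : InfinitePlace K // IsReal w} → ℝ,
      y ∈ ZLattice.comap ℝ (mixedEmbedding.integerLattice K) e.toLinearMap ↔
        ∃ x : 𝓞 K, mixedEmbedding K (x : K) = e y := by
    intro y
    change e y ∈ mixedEmbedding.integerLattice K ↔ _
    simp only [LinearMap.mem_range]
    rfl
  let φ : 𝓞 K → ZLattice.comap ℝ (mixedEmbedding.integerLattice K) e.toLinearMap := fun x =>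
    ⟨e.symm (mixedEmbedding K (x : K)), (hmem _).2 ⟨x, by rw [e.apply_symm_apply]⟩⟩
  have hφval : ∀ x (i : {w : InfinitePlace K // IsReal w}),
      ((φ x : ZLattice.comap ℝ (mixedEmbedding.integerLattice K) e.toLinearMap) :
        {w : InfinitePlace K // IsReal w} → ℝ) i = embedding_of_isReal i.2 (x : K) := by
    intro x i
    change (e.symm (mixedEmbedding K (x : K))) i = _
    rw [he, mixedEmbedding_apply_isReal]
  have hφ : Function.Bijective φ := by
    constructor
    · intro x y hxy
      have h := congrArg (fun z : ZLattice.comap ℝ (mixedEmbedding.integerLattice K) e.toLinearMap =>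
        e (z : {w : InfinitePlace K // IsReal w} → ℝ)) hxy
      simp only [φ, e.apply_symm_apply] at h
      exact RingOfIntegers.coe_injective ((mixedEmbedding_injective K) h)
    · rintro ⟨y, hy⟩
      obtain ⟨x, hx⟩ := (hmem y).1 hy
      refine ⟨x, Subtype.ext ?_⟩
      change e.symm (mixedEmbedding K (x : K)) = y
      rw [hx, e.symm_apply_apply]
  let ε : 𝓞 K ≃ ZLattice.comap ℝ (mixedEmbedding.integerLattice K) e.toLinearMap :=
    Equiv.ofBijective φ hφ
  have hcomp : (fun x : 𝓞 K =>
      ∏ w, g w ((a w + embedding_of_isReal (IsTotallyReal.isReal w) (x : K)) / T)) =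
      (fun ξ : ZLattice.comap ℝ (mixedEmbedding.integerLattice K) e.toLinearMap =>
        ∏ i : {w : InfinitePlace K // IsReal w},
          g i.1 (((fun i : {w : InfinitePlace K // IsReal w} => a i.1) +
            (ξ : {w : InfinitePlace K // IsReal w} → ℝ)) i / T)) ∘ ε := by
    funext x
    rw [Function.comp_apply,
      ← hprod (fun w => g w ((a w + embedding_of_isReal (IsTotallyReal.isReal w) (x : K)) / T))]
    refine Finset.prod_congr rfl fun i _ => ?_
    rw [Pi.add_apply, show ((ε x : ZLattice.comap ℝ (mixedEmbedding.integerLattice K) e.toLinearMap) :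
      {w : InfinitePlace K // IsReal w} → ℝ) i = embedding_of_isReal i.2 (x : K) from hφval x i]
  refine ⟨?_, ?_⟩
  · rw [hcomp]
    exact ε.summable_iff.mpr hsum
  · rw [hcomp]
    exact (ε.tsum_eq (fun ξ : ZLattice.comap ℝ (mixedEmbedding.integerLattice K) e.toLinearMap =>
      ∏ i : {w : InfinitePlace K // IsReal w},
        g i.1 (((fun i : {w : InfinitePlace K // IsReal w} => a i.1) +
          (ξ : {w : InfinitePlace K // IsReal w} → ℝ)) i / T))).trans_le hle

end Literature.NumberTheory.NumberFields
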